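import Summits.RiemannHypothesis.RiemannHypothesis.Theorems.PfPersistenceBarrierWalls
import Literature.NumberTheory.LFunctions.WeilArchimedeanPositivityProofs
import Literature.NumberTheory.LFunctions.UniformWeilPositivityRH
import HarnessLib

/-!
# PF-persistence BARRIER, II: explicit-formula data and the prime locality of Weil windows

Framing (page 1 of every `pub-rhpf` file): **long-odds MECHANISM SEARCH — nothing here is a claim
about RH.**  Every RH-bearing proposition is an explicit HYPOTHESIS of a theorem or one side of a
proved `↔` with a tree theorem; the negativity of a control family is never asserted unless PROVED
(it enters as a hypothesis `… ∈ Neg`, documented as observatory DATA in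
`run/shared/lean/pub/pub-rhpf/pub-rhpf-barrier-prover/PROOF-PLAN.md`).

Contents (overview in `PfPersistenceBarrierWalls`): the record type `ExplicitDatum` (smooth part +
weighted point masses), its explicit-formula functional, Weil quadratic form `quadratic` and
windows `window a`; window positivity `Positivity` / `PositivityOn A`; agreement of point masses
below a cutoff `AgreeBelow` and the PRIME LOCALITY theorem `quadratic_eq_of_agreeBelow`: data
agreeing on the masses of position `≤ 2A` (and on the smooth part) have identical windows `a ≤ A`
(the autocorrelation of a test supported in `[-a, a]` lives in `[-2a, 2a]`); window-local
predicates `IsWindowLocal P A` and the Weil instance of the locality wall W1,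
`no_windowLocal_discriminator`.
-/

set_option linter.dupNamespace false

noncomputable section

open MeasureTheory Set Filter Complex
open scoped Real Topology ComplexConjugate ContDiff

namespace Summit.RiemannHypothesis.RiemannHypothesis.Theorems.PfPersistenceBarrier

open Literature.NumberTheory.LFunctions

/-! ## Concrete layer: explicit-formula data and their Weil windows -/

/-- An EXPLICIT-FORMULA DATUM: a "smooth part" `smooth` (for `ζ`: polar + archimedean term) and
countably many point masses of weight `wt i` at positions `± pos i` (for `ζ`: `Λ(n)/√n` at
`± log n`).  All declared control families of the observatory with `ζ`'s archimedean dressing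
(planted, primedel, lambdapert, noprimes/nopowers, Beurling) are of this form with
`smooth = zetaDatum.smooth` (`pub-weilobs/CONTROLS.md` §2 (B), (D)). [folklore] -/
structure ExplicitDatum where
  /-- the smooth (polar + archimedean) part of the explicit-formula functional -/
  smooth : (ℝ → ℂ) → ℂ
  /-- positions of the point masses (logarithms of generalised prime powers) -/
  pos : ℕ → ℝ
  /-- weights of the point masses -/
  wt : ℕ → ℂ

namespace ExplicitDatum

/-- The prime-type term `∑ᵢ wᵢ (k(posᵢ) + k(-posᵢ))`. [folklore] -/
def primeTerm (F : ExplicitDatum) (k : ℝ → ℂ) : ℂ :=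
  ∑' i : ℕ, F.wt i * (k (F.pos i) + k (-F.pos i))

/-- The linear functional `W_F(k) = smooth(k) − primeTerm(k)`. [folklore] -/
def functional (F : ExplicitDatum) (k : ℝ → ℂ) : ℂ :=
  F.smooth k - F.primeTerm k

/-- The quadratic functional `Q_F(g) = W_F(g ⋆ g̃)`. [folklore] -/
def quadratic (F : ExplicitDatum) (g : ℝ → ℂ) : ℂ :=
  F.functional (weilConv g (weilReflect g))

open Classical in
/-- The WINDOW RECORD at cutoff `a`: the quadratic functional on functions supported in `[-a, a]`
(value `0` off the window, so that the record at `a` carries no information beyond it). [folklore] -/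
def window (F : ExplicitDatum) (a : ℝ) (g : ℝ → ℂ) : ℂ :=
  if tsupport g ⊆ Icc (-a) a then F.quadratic g else 0

/-- Window positivity at all windows (for `zetaDatum` this is `WeilPositivity`,
`zetaDatum_positivity_iff`). [folklore] -/
def Positivity (F : ExplicitDatum) : Prop :=
  ∀ g : ℝ → ℂ, IsWeilTest g → 0 ≤ (F.quadratic g).re

/-- Window positivity up to cutoff `A`. [folklore] -/
def PositivityOn (F : ExplicitDatum) (A : ℝ) : Prop :=
  ∀ g : ℝ → ℂ, IsWeilTest g → tsupport g ⊆ Icc (-A) A → 0 ≤ (F.quadratic g).re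

/-- The `i`-th point mass of `F` is INVISIBLE below `B`: weight `0`, or position of modulus `> B`. [folklore] -/
def Invisible (F : ExplicitDatum) (B : ℝ) (i : ℕ) : Prop :=
  F.wt i = 0 ∨ B < |F.pos i|

/-- `F` and `G` AGREE BELOW `B`: index by index, either both point masses are invisible below `B`
or they coincide (same position, same weight).  Indexing aligned; zero weights are free slots. [folklore] -/
def AgreeBelow (F G : ExplicitDatum) (B : ℝ) : Prop :=
  ∀ i, (F.Invisible B i ∧ G.Invisible B i) ∨ (F.pos i = G.pos i ∧ F.wt i = G.wt i)

/-- `AgreeBelow` is reflexive. [folklore] -/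
theorem AgreeBelow.refl (F : ExplicitDatum) (B : ℝ) : AgreeBelow F F B :=
  fun _ ↦ Or.inr ⟨rfl, rfl⟩

/-- `AgreeBelow` is symmetric. [folklore] -/
theorem AgreeBelow.symm {F G : ExplicitDatum} {B : ℝ} (h : AgreeBelow F G B) : AgreeBelow G F B :=
  fun i ↦ (h i).imp And.symm fun hp ↦ ⟨hp.1.symm, hp.2.symm⟩

/-- Agreement below `B` implies agreement below any smaller `B'`. [folklore] -/
theorem AgreeBelow.anti {F G : ExplicitDatum} {B B' : ℝ} (h : AgreeBelow F G B) (hB : B' ≤ B) :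
    AgreeBelow F G B' := by
  intro i
  rcases h i with ⟨hF, hG⟩ | hp
  · refine Or.inl ⟨?_, ?_⟩
    · exact hF.imp_right fun h1 ↦ lt_of_le_of_lt hB h1
    · exact hG.imp_right fun h1 ↦ lt_of_le_of_lt hB h1
  · exact Or.inr hp

/-- A function with `tsupport k ⊆ [-B, B]` vanishes at every `y` with `B < |y|`. [folklore] -/
theorem apply_eq_zero_of_tsupport_subset {k : ℝ → ℂ} {B y : ℝ} (hk : tsupport k ⊆ Icc (-B) B)
    (hy : B < |y|) : k y = 0 := by
  refine image_eq_zero_of_notMem_tsupport fun hmem ↦ ?_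
  have h := hk hmem
  rw [mem_Icc] at h
  have : |y| ≤ B := abs_le.2 ⟨h.1, h.2⟩
  linarith

/-- An invisible point mass contributes nothing on `[-B, B]`. [folklore] -/
theorem term_eq_zero_of_invisible {F : ExplicitDatum} {B : ℝ} {i : ℕ} (h : F.Invisible B i)
    {k : ℝ → ℂ} (hk : tsupport k ⊆ Icc (-B) B) :
    F.wt i * (k (F.pos i) + k (-F.pos i)) = 0 := by
  rcases h with h | h
  · rw [h, zero_mul]
  · rw [apply_eq_zero_of_tsupport_subset hk h,
      apply_eq_zero_of_tsupport_subset hk (by rwa [abs_neg]), add_zero, mul_zero]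

/-- **Prime locality of the linear functional.** Data agreeing below `B` with the same smooth
part have the same functional on every `k` supported in `[-B, B]`. [folklore] -/
theorem functional_eq_of_agreeBelow {F G : ExplicitDatum} {B : ℝ} (h : AgreeBelow F G B)
    (hs : F.smooth = G.smooth) {k : ℝ → ℂ} (hk : tsupport k ⊆ Icc (-B) B) :
    F.functional k = G.functional k := by
  unfold functional primeTerm
  rw [hs]
  congr 1
  refine tsum_congr fun i ↦ ?_
  rcases h i with ⟨hF, hG⟩ | ⟨hp, hw⟩
  · rw [term_eq_zero_of_invisible hF hk, term_eq_zero_of_invisible hG hk]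
  · rw [hp, hw]

/-- `tsupport g ⊆ [-a, a]` makes `g` compactly supported. [folklore] -/
theorem hasCompactSupport_of_tsupport_subset {g : ℝ → ℂ} {a : ℝ} (hg : tsupport g ⊆ Icc (-a) a) :
    HasCompactSupport g :=
  isCompact_Icc.of_isClosed_subset (isClosed_tsupport g) hg

/-- **Prime locality of the Weil window (the TWIN LEMMA).** If `F` and `G` agree below `2A` and
have the same smooth part, then `Q_F(g) = Q_G(g)` for every `g` supported in `[-a, a]`, `a ≤ A`:
the autocorrelation `g ⋆ g̃` is supported in `[-2a, 2a]` (tree lemma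
`tsupport_weilConv_weilReflect_subset`, Yoshida 1992 §2), where the two prime terms coincide.
[cite: Yoshida1992, §2 (supp F ⊆ [-2a, 2a])] -/
theorem quadratic_eq_of_agreeBelow {F G : ExplicitDatum} {A : ℝ} (h : AgreeBelow F G (2 * A))
    (hs : F.smooth = G.smooth) {a : ℝ} (ha : a ≤ A) {g : ℝ → ℂ}
    (hg : tsupport g ⊆ Icc (-a) a) : F.quadratic g = G.quadratic g := by
  have hk : tsupport (weilConv g (weilReflect g)) ⊆ Icc (-(2 * A)) (2 * A) :=
    (tsupport_weilConv_weilReflect_subset (hasCompactSupport_of_tsupport_subset hg) hg).trans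
      (Icc_subset_Icc (by linarith) (by linarith))
  exact functional_eq_of_agreeBelow h hs hk

/-- **Twins have identical window records up to `A`.** [folklore] -/
theorem window_eq_of_agreeBelow {F G : ExplicitDatum} {A : ℝ} (h : AgreeBelow F G (2 * A))
    (hs : F.smooth = G.smooth) {a : ℝ} (ha : a ≤ A) : F.window a = G.window a := by
  funext g
  unfold window
  split_ifs with hg
  · exact quadratic_eq_of_agreeBelow h hs ha hg
  · rfl

/-- Hence twins agree, as records `ℝ → ((ℝ → ℂ) → ℂ)`, on the window set `Iic A`. [folklore] -/
theorem window_eq_on_Iic_of_agreeBelow {F G : ExplicitDatum} {A : ℝ} (h : AgreeBelow F G (2 * A))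
    (hs : F.smooth = G.smooth) : ∀ a ∈ Iic A, G.window a = F.window a :=
  fun _ ha ↦ (window_eq_of_agreeBelow h hs ha).symm

/-- Window positivity up to `A` is shared by twins below `2A`. [folklore] -/
theorem positivityOn_iff_of_agreeBelow {F G : ExplicitDatum} {A : ℝ} (h : AgreeBelow F G (2 * A))
    (hs : F.smooth = G.smooth) : F.PositivityOn A ↔ G.PositivityOn A := by
  refine forall₃_congr fun g _ hg ↦ ?_
  rw [quadratic_eq_of_agreeBelow h hs le_rfl hg]

/-- Positivity at all windows is the conjunction of the window positivities (a test function has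
compact support, hence lives in some window). [folklore] -/
theorem positivity_iff_forall_positivityOn (F : ExplicitDatum) :
    F.Positivity ↔ ∀ A, F.PositivityOn A := by
  constructor
  · exact fun h A g hg _ ↦ h g hg
  · intro h g hg
    obtain ⟨r, hr⟩ := hg.2.isCompact.isBounded.subset_closedBall 0
    refine h r g hg (hr.trans fun x hx ↦ ?_)
    rw [Metric.mem_closedBall, dist_zero_right, Real.norm_eq_abs] at hx
    exact mem_Icc.2 (abs_le.1 hx)

end ExplicitDatum

open ExplicitDatum

/-! ### Window-local predicates of data and the Weil instance of W1 -/

/-- A predicate of explicit-formula data is WINDOW-LOCAL UP TO `A` if it only depends on the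
window records `a ≤ A` (every invariant computed from a dataset whose windows stop at `A`). [folklore] -/
def IsWindowLocal (P : ExplicitDatum → Prop) (A : ℝ) : Prop :=
  ∀ F G : ExplicitDatum, (∀ a ≤ A, F.window a = G.window a) → (P F ↔ P G)

/-- Window-locality up to `A` implies window-locality up to any `A' ≥ A`. [folklore] -/
theorem IsWindowLocal.mono {P : ExplicitDatum → Prop} {A A' : ℝ} (h : IsWindowLocal P A)
    (hA : A ≤ A') : IsWindowLocal P A' :=
  fun F G hFG ↦ h F G fun a ha ↦ hFG a (ha.trans hA)

/-- Window-locality up to `A` is locality of the induced record predicate on `Iic A`: if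
`P F ↔ P' F.window` for a record predicate `P'` local on `Iic A`, then `P` is window-local. [folklore] -/
theorem isWindowLocal_of_isLocal {P : ExplicitDatum → Prop} {P' : (ℝ → (ℝ → ℂ) → ℂ) → Prop}
    {A : ℝ} (hP' : IsLocal P' (Iic A)) (hPP' : ∀ F, P F ↔ P' F.window) : IsWindowLocal P A :=
  fun F G hFG ↦ by rw [hPP', hPP', hP' F.window G.window fun a ha ↦ hFG a ha]

/-- Window positivity up to `A` is window-local up to `A`. [folklore] -/
theorem positivityOn_isWindowLocal (A : ℝ) : IsWindowLocal (fun F ↦ F.PositivityOn A) A := by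
  intro F G hFG
  refine forall₃_congr fun g _ hg ↦ ?_
  have h := congrFun (hFG A le_rfl) g
  simp only [ExplicitDatum.window, if_pos hg] at h
  rw [h]

/-- A twin below `2A` in `Neg` is a twin of the window record on `Iic A`. [folklore] -/
theorem hasTwinOn_window_of_agreeBelow {Neg : Set ExplicitDatum} {F G : ExplicitDatum} {A : ℝ}
    (hG : G ∈ Neg) (htwin : AgreeBelow F G (2 * A)) (hs : F.smooth = G.smooth) :
    HasTwinOn F.window (ExplicitDatum.window '' Neg) (Iic A) :=
  ⟨G.window, mem_image_of_mem _ hG, window_eq_on_Iic_of_agreeBelow htwin hs⟩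

/-- **W1, Weil instance (data form).** If the negative class contains a twin of `F` below `2A`
(same smooth part, same point masses of position `≤ 2A`), no predicate window-local up to `A`
discriminates `F` from it. [folklore] -/
theorem no_windowLocal_discriminator {P : ExplicitDatum → Prop} {A : ℝ} {Neg : Set ExplicitDatum}
    (hP : IsWindowLocal P A) {F G : ExplicitDatum} (hG : G ∈ Neg) (htwin : AgreeBelow F G (2 * A))
    (hs : F.smooth = G.smooth) : ¬ Discriminates P F Neg := by
  rintro ⟨hF, hno⟩
  exact hno G hG ((hP F G fun a ha ↦ window_eq_of_agreeBelow htwin hs ha).1 hF)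

/-- **W1, Weil instance (record form).** The same for predicates of the window record local on
`Iic A`, via the abstract wall `no_local_discriminator`. [folklore] -/
theorem no_local_record_discriminator {P : (ℝ → (ℝ → ℂ) → ℂ) → Prop} {A : ℝ}
    {Neg : Set ExplicitDatum} (hP : IsLocal P (Iic A)) {F G : ExplicitDatum} (hG : G ∈ Neg)
    (htwin : AgreeBelow F G (2 * A)) (hs : F.smooth = G.smooth) :
    ¬ Discriminates P F.window (ExplicitDatum.window '' Neg) :=
  no_local_discriminator hP (hasTwinOn_window_of_agreeBelow hG htwin hs)

end Summit.RiemannHypothesis.RiemannHypothesis.Theorems.PfPersistenceBarrier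

end
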